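import Mathlib
import Summits.ValiantsHypothesis.ValiantsHypothesis.Theses.FreeSubtorus
import Summits.ValiantsHypothesis.ValiantsHypothesis.Theses.RigidityForcesSymmetry
import Summits.ValiantsHypothesis.ValiantsHypothesis.Theorems.FreeSubtorusSubtorusCovering
import Summits.ValiantsHypothesis.ValiantsHypothesis.Theorems.BorderApolarityToricWitnessObstructionQPStubTorusBound
import Summits.ValiantsHypothesis.ValiantsHypothesis.Cruxes.OrbitDimensionBound.Lines.PiecewiseLadder

/-!
# `piecewise_covering` — SPECIAL CASES (forward rung g4, crux `FreeSubtorus.OrbitDimensionBound`)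

Sorry-free checks that the rung family `Piecewise.SumCovering K` / `Piecewise.PiecewiseCovering` sits correctly
relative to the proved floor and to the landed `TorusBound`:

* (a) `K = 1` of the family IS the floor: `SumCovering 1` holds outright (`sumCovering_one`, from the landed
  `subtorusCovering_proof`), and `PieceCovering 1 ↔ SubtorusCovering`.
* (b) the rung implies the floor (`rung → seed`), and the dial is antitone (`SumCovering K' → SumCovering K` for
  `K ≤ K'`): the family is a genuine ladder above the floor.
* (c) FIRST RUNG OF THE NEW STUB: the `k = 1` case of `stub_piecewiseTorusBound` (piecewise Landsberg–Ressayre,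
  the line's load-bearing stub) follows from the LANDED `TorusBound` (`2^n - 1 ≤ m`): a one-piece full-torus
  decomposition of `per_n` has `C(n,⌊n/2⌋) ≤ 1 · m`.  (Stated here over the same generating set as `TorusBound`.)
* (d) the host crux implies the relaxed symmetrisation target: `OrbitDimensionBound → OrbitPieceBound`
  (one piece), so `closes_piecewise` is at least as usable as the route's `closes`.
-/

set_option linter.dupNamespace false

noncomputable section

namespace Summit.ValiantsHypothesis.ValiantsHypothesis.Cruxes.OrbitDimensionBound.Piecewise.Special

open MvPolynomial
open Literature.Computability.AlgebraicComplexity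
open Summit.ValiantsHypothesis.ValiantsHypothesis.Cruxes.OrbitDimensionBound.Piecewise

/-- (a) `K = 1` of the family is exactly the proved floor. -/
example : SumCovering 1 := sumCovering_one

/-- (a') one piece ↔ the floor `SubtorusCovering`. -/
example : PieceCovering 1 ↔ Summit.ValiantsHypothesis.ValiantsHypothesis.Theses.FreeSubtorus.SubtorusCovering :=
  pieceCovering_one_iff

/-- (b) the rung implies the floor (seed `g1-ValiantsHypothesis-16134`). -/
theorem floor_of_rung (h : PiecewiseCovering) :
    Summit.ValiantsHypothesis.ValiantsHypothesis.Theses.FreeSubtorus.SubtorusCovering :=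
  subtorusCovering_of_piecewiseCovering h

/-- (b') the dial is antitone: more pieces allowed = stronger statement. -/
example {K K' : ℕ} (hKK' : K ≤ K') (h : SumCovering K') : SumCovering K := SumCovering.anti hKK' h

/-- (b'') the rung is the top of the dial. -/
example : PiecewiseCovering ↔ ∀ K, SumCovering K := piecewiseCovering_iff

/-- (c) **First rung of the new stub** (`k = 1` of piecewise Landsberg–Ressayre) from the LANDED `TorusBound`:
a ONE-piece full-torus-equivariant decomposition of `per_n`, `n ≥ 3`, has `C(n,⌊n/2⌋) ≤ 1 · m`.
[cite: LandsbergRessayre2017, Thm. 2.8] -/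
theorem piecewiseTorusBound_one (n m : ℕ) (hn : 3 ≤ n)
    (P : Fin 1 → MvPolynomial (Fin n × Fin n) ℂ)
    (B : Fin 1 → Matrix (Fin m) (Fin m) (MvPolynomial (Fin n × Fin n) ℂ))
    (hsum : (∑ i, P i) = perPoly (Fin n) ℂ)
    (hB : ∀ i, IsEquivariantDetRepr
      (Subgroup.closure {γ : GL (Fin n × Fin n) ℂ | ∃ d e : Fin n → ℂ,
        (γ : Matrix (Fin n × Fin n) (Fin n × Fin n) ℂ) = Matrix.diagonal (fun p => d p.1 * e p.2)})
      (P i) (B i)) :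
    Nat.choose n (n / 2) ≤ 1 * m := by
  have hP0 : P 0 = perPoly (Fin n) ℂ := by simpa using hsum
  have hT := Summit.ValiantsHypothesis.ValiantsHypothesis.Theorems.BorderApolarityToricWitnessObstructionQP.stub_torusBound
    n hn m (B 0) (hP0 ▸ hB 0)
  -- `C(n,⌊n/2⌋) ≤ 2^(n-1) ≤ 2^n - 1 ≤ m`
  have h1 := Summit.ValiantsHypothesis.ValiantsHypothesis.Theorems.FreeSubtorusSubtorusCovering.choose_middle_le_two_pow_pred
    n (by omega)
  have h2 : 2 ^ (n - 1) ≤ 2 ^ n - 1 := by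
    have h3 : 2 ^ n = 2 * 2 ^ (n - 1) := by rw [← pow_succ']; congr 1; omega
    have h4 : 1 ≤ 2 ^ (n - 1) := Nat.one_le_two_pow
    omega
  omega

/-- (d) the host crux `OrbitDimensionBound` implies the relaxed target `OrbitPieceBound` (one piece). -/
example (h : Summit.ValiantsHypothesis.ValiantsHypothesis.Theses.FreeSubtorus.OrbitDimensionBound) :
    OrbitPieceBound :=
  orbitPieceBound_of_orbitDimensionBound h

/-- (d') hence the rung + the host crux decide the summit (the ladder's `closes_rung`). -/
example (h₁ : Summit.ValiantsHypothesis.ValiantsHypothesis.Theses.FreeSubtorus.OrbitDimensionBound)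
    (h₂ : PiecewiseCovering) : _root_.ValiantsHypothesis :=
  closes_rung h₁ h₂

end Summit.ValiantsHypothesis.ValiantsHypothesis.Cruxes.OrbitDimensionBound.Piecewise.Special

end
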